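import Literature.Geometry.Riemannian.SphericalZonalHamiltonHarnack
import Literature.Geometry.Riemannian.SphericalCylinderEntropySmallScales
import Mathlib.Analysis.Convex.Deriv
import HarnessLib

/-!
# Cheap rigorous bounds for the zonal heat kernel of `S⁴`: Hamilton's Gaussian minorant and
# rational-weight partial sums with a geometric tail

Sixth file on the typed zonal heat series
`zonal τ s = ∑_k e^{-k(k+3)τ} (2k+3)/3 · C_k^{(3/2)}(s)` of `SphericalCylinderEntropy.lean`
(`vol(S⁴)` times the heat kernel of the round `S⁴` at time `τ`, `s = cos (geodesic distance)`).
The kernel-domination certificates of route `SmoothPoincare4/CylinderEntropy` (line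
`conformal-kernel-domination` of the crux `SliceIsolation`) are finite families of real
inequalities "pulled-back Gaussian `≤ Σ_j w_j · zonal (τ_j, s) · Gaussian_j (u) + c`", verified cell
by cell; every such verification needs CHEAP, SHARP and RIGOROUS lower (and upper) bounds for
`zonal`.  We provide two families, everything proved (no named facts, no definitions).

**A. Hamilton's Gaussian minorant** (from the proved logarithmic convexity
`convexOn_log_zonal_cos` of `θ ↦ log (zonal τ (cos θ)) + θ²/(4τ)`, R. S. Hamilton, Comm. Anal.
Geom. 1 (1993), p. 114, and the evenness of that function):
* `log_zonal_one_le` — `log (zonal τ 1) ≤ log (zonal τ (cos θ)) + θ²/(4τ)`;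
* `zonal_one_mul_exp_neg_le_zonal_cos` — **`zonal τ 1 · e^{-θ²/(4τ)} ≤ zonal τ (cos θ)`**, and its
  `arccos` form `zonal_one_mul_exp_neg_arccos_sq_le_zonal` (`s ∈ [-1, 1]`);
* `zonal_cos_lower_of_abs_le`, `zonal_cos_lower_of_le`, `zonal_lower_of_le`, `exp_neg_le_zonal_cos`
  — the monotone-in-`θ²` corollaries used on cells;
* `convexOn_univ_tangent_line_le`, `hasDerivAt_log_zonal_cos`, `deriv_log_zonal_cos`,
  `zonal_cos_mul_exp_tangent_le` — the **tangent form** at a general angle `θ₀`: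
  `zonal τ (cos θ₀) · exp (D (θ - θ₀) - (θ - θ₀)²/(4τ)) ≤ zonal τ (cos θ)` with
  `D = (log (zonal τ (cos ·)))' (θ₀) = -sin θ₀ · 5 e^{-4τ} zonalSix τ (cos θ₀) / zonal τ (cos θ₀)`.

**B. Rational-weight partial sums with a closed-form geometric tail.** For `0 < q < 1` and
`τ = -(log q)/2` the heat weights are `e^{-k(k+3)τ} = q^{k(k+3)/2}` EXACTLY (`k(k+3)` is even,
`exp_neg_mul_tau_eq_pow`), so for rational `q` the partial sums are polynomials in `s` with
rational coefficients; the tail after `K` terms is dominated through the tree's term bound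
`|wt k τ C_k(s)| ≤ e^{-k(k+3)τ} 32^k` (`abs_term_le_majorant`) and `k(k+3)/2 ≥ k ⌊(K+4)/2⌋`
(`k ≥ K + 1`) by the geometric series of ratio `ρ = 32 q^{⌊(K+4)/2⌋}`:
* `abs_zonal_sub_partialSum_le_geometric` —
  **`|zonal (-(log q)/2) s - Σ_{k ≤ K} q^{k(k+3)/2} (2k+3)/3 · C_k(s)| ≤ ρ^{K+1}/(1 - ρ)`** for
  `|s| ≤ 1`, `ρ < 1` (a right-hand side `norm_num` evaluates);
* `partialSum_sub_geometric_le_zonal`, `zonal_le_partialSum_add_geometric` — the two-sided form;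
* `gegen_one` — `C_k^{(3/2)}(1) = (k+1)(k+2)/2`, and `abs_zonal_one_sub_partialSum_le_geometric` —
  the value at the pole; `zonal_le_zonal_one`, `zonal_le_partialSum_one_add_geometric` — rational
  UPPER bounds on all of `[-1, 1]`; `partialSum_one_mul_exp_neg_le_zonal_cos` — the Gaussian
  minorant of part A with the pole value replaced by its rational lower bound.
Two `example`s at the end show the `norm_num` recipe a certificate cell uses.

## References
* R. S. Hamilton, *A matrix Harnack estimate for the heat equation*, Comm. Anal. Geom. 1 (1993)
  113–126, p. 114. [Hamilton1993Harnack]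
* NIST DLMF §18.5.10 (explicit sum for `C_n^{(λ)}`), §18.14 (values at `1`).
-/

noncomputable section

open Set Filter
open scoped Topology BigOperators
open Literature.Geometry.Riemannian.SphericalCylinderEntropy
open Literature.Analysis.SpecialFunctions

namespace Literature.Geometry.Riemannian.SphericalZonalKernelSeries

/-! ### A. Hamilton's Gaussian minorant -/

/-- Midpoint form of Hamilton's logarithmic convexity between `-θ` and `θ` (the convex function
`θ ↦ log (zonal τ (cos θ)) + θ²/(4τ)` is even): `log (zonal τ 1) ≤ log (zonal τ (cos θ)) + θ²/(4τ)`.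
[cite: Hamilton1993Harnack, p. 114] -/
theorem log_zonal_one_le {τ : ℝ} (hτ : 0 < τ) (θ : ℝ) :
    Real.log (zonal τ 1) ≤ Real.log (zonal τ (Real.cos θ)) + θ ^ 2 / (4 * τ) := by
  have hconv := convexOn_log_zonal_cos hτ
  have hmid := hconv.2 (mem_univ (-θ)) (mem_univ θ) (by norm_num : (0 : ℝ) ≤ 1 / 2)
    (by norm_num : (0 : ℝ) ≤ 1 / 2) (by norm_num)
  have hpt : (1 / 2 : ℝ) • (-θ) + (1 / 2 : ℝ) • θ = 0 := by
    simp only [smul_eq_mul]; ring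
  rw [hpt] at hmid
  simp only [smul_eq_mul, Real.cos_neg, Real.cos_zero, neg_sq] at hmid
  have h0 : (0 : ℝ) ^ 2 / (4 * τ) = 0 := by rw [zero_pow two_ne_zero, zero_div]
  linarith

/-- **Hamilton's Gaussian minorant for the zonal heat kernel of `S⁴`**: for `τ > 0` and every
angle `θ`, `zonal τ 1 · e^{-θ²/(4τ)} ≤ zonal τ (cos θ)` (the heat kernel at geodesic distance `θ`
is at least its value at the pole times the Euclidean Gaussian factor).
[cite: Hamilton1993Harnack, p. 114] -/
theorem zonal_one_mul_exp_neg_le_zonal_cos {τ : ℝ} (hτ : 0 < τ) (θ : ℝ) :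
    zonal τ 1 * Real.exp (-θ ^ 2 / (4 * τ)) ≤ zonal τ (Real.cos θ) := by
  have hlog := log_zonal_one_le hτ θ
  have h1 : 0 < zonal τ 1 := lt_of_lt_of_le one_pos (one_le_zonal_one hτ)
  have hc : 0 < zonal τ (Real.cos θ) := zonal_cos_pos hτ θ
  have h : Real.log (zonal τ 1 * Real.exp (-θ ^ 2 / (4 * τ))) ≤
      Real.log (zonal τ (Real.cos θ)) := by
    rw [Real.log_mul h1.ne' (Real.exp_pos _).ne', Real.log_exp, neg_div]
    linarith
  exact (Real.log_le_log_iff (mul_pos h1 (Real.exp_pos _)) hc).1 h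

/-- The `arccos` form of Hamilton's Gaussian minorant: for `s ∈ [-1, 1]`,
`zonal τ 1 · e^{-(arccos s)²/(4τ)} ≤ zonal τ s`. [cite: Hamilton1993Harnack, p. 114] -/
theorem zonal_one_mul_exp_neg_arccos_sq_le_zonal {τ : ℝ} (hτ : 0 < τ) {s : ℝ} (hs1 : -1 ≤ s)
    (hs2 : s ≤ 1) :
    zonal τ 1 * Real.exp (-(Real.arccos s) ^ 2 / (4 * τ)) ≤ zonal τ s := by
  have h := zonal_one_mul_exp_neg_le_zonal_cos hτ (Real.arccos s)
  rwa [Real.cos_arccos hs1 hs2] at h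

/-- The Gaussian minorant is monotone in `θ²`: for `|θ| ≤ θ₁`,
`zonal τ 1 · e^{-θ₁²/(4τ)} ≤ zonal τ (cos θ)`. [folklore] -/
theorem zonal_cos_lower_of_abs_le {τ : ℝ} (hτ : 0 < τ) {θ θ₁ : ℝ} (h : |θ| ≤ θ₁) :
    zonal τ 1 * Real.exp (-θ₁ ^ 2 / (4 * τ)) ≤ zonal τ (Real.cos θ) := by
  refine le_trans ?_ (zonal_one_mul_exp_neg_le_zonal_cos hτ θ)
  have h1 : 0 < zonal τ 1 := lt_of_lt_of_le one_pos (one_le_zonal_one hτ)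
  refine mul_le_mul_of_nonneg_left (Real.exp_le_exp.2 ?_) h1.le
  have hsq : θ ^ 2 ≤ θ₁ ^ 2 := by
    rw [← sq_abs θ]
    exact pow_le_pow_left₀ (abs_nonneg θ) h 2
  rw [neg_div, neg_div, neg_le_neg_iff]
  exact div_le_div_of_nonneg_right hsq (by positivity)

/-- For `0 ≤ θ ≤ θ₁`: `zonal τ 1 · e^{-θ₁²/(4τ)} ≤ zonal τ (cos θ)`. [folklore] -/
theorem zonal_cos_lower_of_le {τ : ℝ} (hτ : 0 < τ) {θ θ₁ : ℝ} (h0 : 0 ≤ θ) (h1 : θ ≤ θ₁) :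
    zonal τ 1 * Real.exp (-θ₁ ^ 2 / (4 * τ)) ≤ zonal τ (Real.cos θ) :=
  zonal_cos_lower_of_abs_le hτ (by rwa [abs_of_nonneg h0])

/-- Cell form in the cosine variable: for `-1 ≤ s₁ ≤ s ≤ 1`,
`zonal τ 1 · e^{-(arccos s₁)²/(4τ)} ≤ zonal τ s` (`arccos` is antitone). [folklore] -/
theorem zonal_lower_of_le {τ : ℝ} (hτ : 0 < τ) {s₁ s : ℝ} (hs₁ : -1 ≤ s₁) (h1 : s₁ ≤ s)
    (h2 : s ≤ 1) :
    zonal τ 1 * Real.exp (-(Real.arccos s₁) ^ 2 / (4 * τ)) ≤ zonal τ s := by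
  have h := zonal_cos_lower_of_le hτ (Real.arccos_nonneg s) (Real.arccos_le_arccos h1)
  rwa [Real.cos_arccos (hs₁.trans h1) h2] at h

/-- The pure Gaussian minorant `e^{-θ²/(4τ)} ≤ zonal τ (cos θ)` (as `zonal τ 1 ≥ 1`). [folklore] -/
theorem exp_neg_le_zonal_cos {τ : ℝ} (hτ : 0 < τ) (θ : ℝ) :
    Real.exp (-θ ^ 2 / (4 * τ)) ≤ zonal τ (Real.cos θ) := by
  refine le_trans ?_ (zonal_one_mul_exp_neg_le_zonal_cos hτ θ)
  have h1 := one_le_zonal_one hτ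
  nlinarith [Real.exp_pos (-θ ^ 2 / (4 * τ))]

/-! ### A'. The tangent form at a general angle -/

/-- Tangent-line inequality for a convex function on `ℝ` differentiable at `a`:
`f a + f' (t - a) ≤ f t`. [folklore] -/
theorem convexOn_univ_tangent_line_le {f : ℝ → ℝ} (hf : ConvexOn ℝ univ f) {a f' : ℝ}
    (ha : HasDerivAt f f' a) (t : ℝ) : f a + f' * (t - a) ≤ f t := by
  rcases lt_trichotomy a t with hat | rfl | hta
  · have h1 := hf.le_slope_of_hasDerivAt (mem_univ a) (mem_univ t) hat ha
    rw [slope_def_field, le_div_iff₀ (sub_pos.2 hat)] at h1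
    linarith
  · simp
  · have h1 := hf.slope_le_of_hasDerivAt (mem_univ t) (mem_univ a) hta ha
    rw [slope_def_field, div_le_iff₀ (sub_pos.2 hta)] at h1
    linarith

/-- The derivative of `x ↦ log (zonal τ (cos x))`:
`-sin x · (5 e^{-4τ} zonalSix τ (cos x)) / zonal τ (cos x)` (chain rule with `hasDerivAt_zonal`).
[folklore] -/
theorem hasDerivAt_log_zonal_cos {τ : ℝ} (hτ : 0 < τ) (x : ℝ) :
    HasDerivAt (fun y => Real.log (zonal τ (Real.cos y)))
      (-Real.sin x * (5 * Real.exp (-4 * τ) * zonalSix τ (Real.cos x)) / zonal τ (Real.cos x))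
      x := by
  have hf : HasDerivAt (fun y => zonal τ (Real.cos y))
      (5 * Real.exp (-4 * τ) * zonalSix τ (Real.cos x) * -Real.sin x) x :=
    (hasDerivAt_zonal hτ (Real.cos x)).comp x (Real.hasDerivAt_cos x)
  have h := hf.log (zonal_cos_pos hτ x).ne'
  convert h using 1
  ring

/-- `deriv` form of `hasDerivAt_log_zonal_cos`. [folklore] -/
theorem deriv_log_zonal_cos {τ : ℝ} (hτ : 0 < τ) (x : ℝ) :
    deriv (fun y => Real.log (zonal τ (Real.cos y))) x =
      -Real.sin x * (5 * Real.exp (-4 * τ) * zonalSix τ (Real.cos x)) / zonal τ (Real.cos x) :=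
  (hasDerivAt_log_zonal_cos hτ x).deriv

/-- **Tangent form of Hamilton's inequality** at a general angle `θ₀`: with
`D = (log (zonal τ (cos ·)))' (θ₀)`,
`zonal τ (cos θ₀) · exp (D (θ - θ₀) - (θ - θ₀)²/(4τ)) ≤ zonal τ (cos θ)` for all `θ`
(the tangent line of the convex function `log (zonal τ (cos θ)) + θ²/(4τ)` at `θ₀`).
[cite: Hamilton1993Harnack, p. 114] -/
theorem zonal_cos_mul_exp_tangent_le {τ : ℝ} (hτ : 0 < τ) (θ₀ θ : ℝ) :
    zonal τ (Real.cos θ₀) *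
        Real.exp (deriv (fun x => Real.log (zonal τ (Real.cos x))) θ₀ * (θ - θ₀) -
          (θ - θ₀) ^ 2 / (4 * τ)) ≤ zonal τ (Real.cos θ) := by
  have hD : HasDerivAt (fun x => Real.log (zonal τ (Real.cos x)))
      (deriv (fun x => Real.log (zonal τ (Real.cos x))) θ₀) θ₀ :=
    (hasDerivAt_log_zonal_cos hτ θ₀).differentiableAt.hasDerivAt
  have h2 : HasDerivAt (fun x : ℝ => x ^ 2 / (4 * τ)) (2 * θ₀ / (4 * τ)) θ₀ := by
    have h := (hasDerivAt_pow 2 θ₀).div_const (4 * τ)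
    simpa using h
  have htan := convexOn_univ_tangent_line_le (convexOn_log_zonal_cos hτ) (hD.add h2) θ
  have h0 : 0 < zonal τ (Real.cos θ₀) := zonal_cos_pos hτ θ₀
  have h1 : 0 < zonal τ (Real.cos θ) := zonal_cos_pos hτ θ
  rw [← Real.log_le_log_iff (mul_pos h0 (Real.exp_pos _)) h1,
    Real.log_mul h0.ne' (Real.exp_pos _).ne', Real.log_exp]
  have key : θ₀ ^ 2 / (4 * τ) + 2 * θ₀ / (4 * τ) * (θ - θ₀) - θ ^ 2 / (4 * τ) =
      -((θ - θ₀) ^ 2 / (4 * τ)) := by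
    field_simp
    ring
  linarith

/-! ### B. Rational weights: `τ = -(log q)/2` -/

/-- `k (k + 3)` is even: `2 · (k(k+3)/2) = k(k+3)` in `ℕ`. [folklore] -/
theorem two_mul_half_mul_add_three (k : ℕ) : 2 * (k * (k + 3) / 2) = k * (k + 3) := by
  have h : Even (k * (k + 3)) := by
    have h2 : k * (k + 3) = k * (k + 1) + 2 * k := by ring
    rw [h2]
    exact (Nat.even_mul_succ_self k).add (even_two_mul k)
  exact Nat.mul_div_cancel' h.two_dvd

/-- **The heat weights at `τ = -(log q)/2` are exact powers**: for `q > 0`,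
`e^{-k(k+3) · (-(log q)/2)} = q^{k(k+3)/2}` (natural exponent, `k(k+3)` being even). [folklore] -/
theorem exp_neg_mul_tau_eq_pow (q : ℝ) (hq : 0 < q) (k : ℕ) :
    Real.exp (-((k : ℝ) * ((k : ℝ) + 3)) * (-(Real.log q) / 2)) = q ^ (k * (k + 3) / 2) := by
  have hcast : (k : ℝ) * ((k : ℝ) + 3) = 2 * ((k * (k + 3) / 2 : ℕ) : ℝ) := by
    have h : ((k * (k + 3) : ℕ) : ℝ) = ((2 * (k * (k + 3) / 2) : ℕ) : ℝ) := by
      rw [two_mul_half_mul_add_three]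
    push_cast at h
    linarith
  have h : -((k : ℝ) * ((k : ℝ) + 3)) * (-(Real.log q) / 2) =
      ((k * (k + 3) / 2 : ℕ) : ℝ) * Real.log q := by
    rw [hcast]; ring
  rw [h, Real.exp_nat_mul, Real.exp_log hq]

/-- The typed weight at `τ = -(log q)/2`: `wt k τ = q^{k(k+3)/2} (2k+3)/3`. [folklore] -/
theorem wt_neg_log_div_two {q : ℝ} (hq : 0 < q) (k : ℕ) :
    wt k (-(Real.log q) / 2) = q ^ (k * (k + 3) / 2) * ((2 * (k : ℝ) + 3) / 3) := by
  rw [wt, exp_neg_mul_tau_eq_pow q hq k]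

/-- `τ = -(log q)/2 > 0` for `0 < q < 1`. [folklore] -/
theorem neg_log_div_two_pos {q : ℝ} (hq0 : 0 < q) (hq1 : q < 1) : 0 < -(Real.log q) / 2 := by
  have h := Real.log_neg hq0 hq1
  linarith

/-- The exponent comparison behind the geometric tail: for `0 ≤ q ≤ 1` and `2m ≤ k + 3`,
`q^{k(k+3)/2} ≤ (q^m)^k`. [folklore] -/
theorem pow_half_mul_add_three_le {q : ℝ} (hq0 : 0 ≤ q) (hq1 : q ≤ 1) {m k : ℕ}
    (hmk : 2 * m ≤ k + 3) : q ^ (k * (k + 3) / 2) ≤ (q ^ m) ^ k := by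
  rw [← pow_mul]
  refine pow_le_pow_of_le_one hq0 hq1 ?_
  rw [Nat.le_div_iff_mul_le two_pos]
  calc m * k * 2 = k * (2 * m) := by ring
    _ ≤ k * (k + 3) := Nat.mul_le_mul_left k hmk

/-- **Partial sums with a closed-form geometric tail**: for `0 < q < 1`, `|s| ≤ 1`, `K : ℕ` and
`ρ := 32 q^{⌊(K+4)/2⌋} < 1`,
`|zonal (-(log q)/2) s - Σ_{k ≤ K} q^{k(k+3)/2} (2k+3)/3 · C_k^{(3/2)}(s)| ≤ ρ^{K+1}/(1 - ρ)`
(tail terms `≤ q^{k(k+3)/2} 32^k ≤ ρ^k` for `k ≥ K + 1`). [folklore] -/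
theorem abs_zonal_sub_partialSum_le_geometric {q : ℝ} (hq0 : 0 < q) (hq1 : q < 1) (K : ℕ)
    {s : ℝ} (hs : |s| ≤ 1) (hρ : 32 * q ^ ((K + 4) / 2) < 1) :
    |zonal (-(Real.log q) / 2) s -
        ∑ k ∈ Finset.range (K + 1), q ^ (k * (k + 3) / 2) * ((2 * (k : ℝ) + 3) / 3) * gegen k s|
      ≤ (32 * q ^ ((K + 4) / 2)) ^ (K + 1) / (1 - 32 * q ^ ((K + 4) / 2)) := by
  have hτ := neg_log_div_two_pos hq0 hq1
  have hsum := summable_term_of_pos hτ hs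
  have hsplit := hsum.sum_add_tsum_nat_add (K + 1)
  have heq : zonal (-(Real.log q) / 2) s -
      ∑ k ∈ Finset.range (K + 1), q ^ (k * (k + 3) / 2) * ((2 * (k : ℝ) + 3) / 3) * gegen k s =
      ∑' i : ℕ, wt (i + (K + 1)) (-(Real.log q) / 2) * gegen (i + (K + 1)) s := by
    have hS : ∑ k ∈ Finset.range (K + 1), q ^ (k * (k + 3) / 2) * ((2 * (k : ℝ) + 3) / 3) *
        gegen k s = ∑ k ∈ Finset.range (K + 1), wt k (-(Real.log q) / 2) * gegen k s :=
      Finset.sum_congr rfl fun k _ => by rw [wt_neg_log_div_two hq0]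
    rw [hS, zonal, ← hsplit, add_sub_cancel_left]
  rw [heq]
  set m : ℕ := (K + 4) / 2 with hm
  set ρ : ℝ := 32 * q ^ m with hρdef
  have hρ0 : 0 ≤ ρ := by positivity
  have htail := tsum_of_norm_bounded
    (f := fun i : ℕ => wt (i + (K + 1)) (-(Real.log q) / 2) * gegen (i + (K + 1)) s)
    ((hasSum_geometric_of_lt_one hρ0 hρ).mul_left (ρ ^ (K + 1))) fun i => by
    rw [Real.norm_eq_abs]
    refine (abs_term_le_majorant _ _ hs).trans ?_
    rw [exp_neg_mul_tau_eq_pow q hq0]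
    calc q ^ ((i + (K + 1)) * ((i + (K + 1)) + 3) / 2) * 32 ^ (i + (K + 1))
        ≤ (q ^ m) ^ (i + (K + 1)) * 32 ^ (i + (K + 1)) :=
          mul_le_mul_of_nonneg_right (pow_half_mul_add_three_le hq0.le hq1.le (by omega))
            (by positivity)
      _ = ρ ^ (K + 1) * ρ ^ i := by rw [hρdef]; ring
  rw [Real.norm_eq_abs, ← div_eq_mul_inv] at htail
  exact htail

/-- Lower form: `Σ_{k ≤ K} q^{k(k+3)/2} (2k+3)/3 · C_k(s) - ρ^{K+1}/(1-ρ) ≤ zonal (-(log q)/2) s`.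
[folklore] -/
theorem partialSum_sub_geometric_le_zonal {q : ℝ} (hq0 : 0 < q) (hq1 : q < 1) (K : ℕ) {s : ℝ}
    (hs : |s| ≤ 1) (hρ : 32 * q ^ ((K + 4) / 2) < 1) :
    ∑ k ∈ Finset.range (K + 1), q ^ (k * (k + 3) / 2) * ((2 * (k : ℝ) + 3) / 3) * gegen k s -
        (32 * q ^ ((K + 4) / 2)) ^ (K + 1) / (1 - 32 * q ^ ((K + 4) / 2)) ≤
      zonal (-(Real.log q) / 2) s := by
  have h := abs_le.1 (abs_zonal_sub_partialSum_le_geometric hq0 hq1 K hs hρ)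
  linarith [h.1]

/-- Upper form: `zonal (-(log q)/2) s ≤ Σ_{k ≤ K} q^{k(k+3)/2} (2k+3)/3 · C_k(s) + ρ^{K+1}/(1-ρ)`.
[folklore] -/
theorem zonal_le_partialSum_add_geometric {q : ℝ} (hq0 : 0 < q) (hq1 : q < 1) (K : ℕ) {s : ℝ}
    (hs : |s| ≤ 1) (hρ : 32 * q ^ ((K + 4) / 2) < 1) :
    zonal (-(Real.log q) / 2) s ≤
      ∑ k ∈ Finset.range (K + 1), q ^ (k * (k + 3) / 2) * ((2 * (k : ℝ) + 3) / 3) * gegen k s +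
        (32 * q ^ ((K + 4) / 2)) ^ (K + 1) / (1 - 32 * q ^ ((K + 4) / 2)) := by
  have h := abs_le.1 (abs_zonal_sub_partialSum_le_geometric hq0 hq1 K hs hρ)
  linarith [h.2]

/-! ### B'. The value at the pole -/

/-- **`C_k^{(3/2)}(1) = (k+1)(k+2)/2`** (from `(n+1) C_{n+1}(1) = (n+3) C_n(1)`, `C_0 = 1`).
[folklore] -/
theorem gegen_one (k : ℕ) : gegen k 1 = ((k : ℝ) + 1) * ((k : ℝ) + 2) / 2 := by
  rw [gegen_eq_gegenbauerSum]
  induction k with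
  | zero => simp
  | succ n ih =>
    have h := gegenbauerSum_at_one_rec (((1 : ℕ) : ℝ) + 1 / 2) n
    rw [ih] at h
    have hn : (n : ℝ) + 1 ≠ 0 := by positivity
    refine mul_left_cancel₀ hn ?_
    rw [h]
    push_cast
    ring

/-- The partial-sum bound at the pole `s = 1`:
`|zonal (-(log q)/2) 1 - Σ_{k ≤ K} q^{k(k+3)/2} (2k+3)/3 · (k+1)(k+2)/2| ≤ ρ^{K+1}/(1-ρ)`.
[folklore] -/
theorem abs_zonal_one_sub_partialSum_le_geometric {q : ℝ} (hq0 : 0 < q) (hq1 : q < 1) (K : ℕ)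
    (hρ : 32 * q ^ ((K + 4) / 2) < 1) :
    |zonal (-(Real.log q) / 2) 1 -
        ∑ k ∈ Finset.range (K + 1), q ^ (k * (k + 3) / 2) * ((2 * (k : ℝ) + 3) / 3) *
          (((k : ℝ) + 1) * ((k : ℝ) + 2) / 2)|
      ≤ (32 * q ^ ((K + 4) / 2)) ^ (K + 1) / (1 - 32 * q ^ ((K + 4) / 2)) := by
  have h := abs_zonal_sub_partialSum_le_geometric hq0 hq1 K (s := 1) (by norm_num) hρ
  simpa only [gegen_one] using h

/-- Upper bounds anywhere from the pole: `zonal τ s ≤ zonal τ 1` for `s ∈ [-1, 1]` (the tree's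
`monotoneOn_zonal`). [folklore] -/
theorem zonal_le_zonal_one {τ : ℝ} (hτ : 0 < τ) {s : ℝ} (hs1 : -1 ≤ s) (hs2 : s ≤ 1) :
    zonal τ s ≤ zonal τ 1 :=
  monotoneOn_zonal hτ ⟨hs1, hs2⟩ ⟨by norm_num, le_rfl⟩ hs2

/-- Rational upper bound on `[-1, 1]`:
`zonal (-(log q)/2) s ≤ Σ_{k ≤ K} q^{k(k+3)/2} (2k+3)/3 · (k+1)(k+2)/2 + ρ^{K+1}/(1-ρ)`. [folklore] -/
theorem zonal_le_partialSum_one_add_geometric {q : ℝ} (hq0 : 0 < q) (hq1 : q < 1) (K : ℕ)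
    {s : ℝ} (hs1 : -1 ≤ s) (hs2 : s ≤ 1) (hρ : 32 * q ^ ((K + 4) / 2) < 1) :
    zonal (-(Real.log q) / 2) s ≤
      ∑ k ∈ Finset.range (K + 1), q ^ (k * (k + 3) / 2) * ((2 * (k : ℝ) + 3) / 3) *
          (((k : ℝ) + 1) * ((k : ℝ) + 2) / 2) +
        (32 * q ^ ((K + 4) / 2)) ^ (K + 1) / (1 - 32 * q ^ ((K + 4) / 2)) := by
  have h := abs_le.1 (abs_zonal_one_sub_partialSum_le_geometric hq0 hq1 K hρ)
  linarith [h.2, zonal_le_zonal_one (neg_log_div_two_pos hq0 hq1) hs1 hs2]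

/-- **Rational Gaussian minorant**: for `0 < q < 1`, `τ = -(log q)/2`, `ρ = 32 q^{⌊(K+4)/2⌋} < 1`,
`(Σ_{k ≤ K} q^{k(k+3)/2} (2k+3)/3 · (k+1)(k+2)/2 - ρ^{K+1}/(1-ρ)) · e^{-θ²/(4τ)} ≤ zonal τ (cos θ)`
(Hamilton's minorant with the pole value bounded below by the partial sum).
[cite: Hamilton1993Harnack, p. 114] -/
theorem partialSum_one_mul_exp_neg_le_zonal_cos {q : ℝ} (hq0 : 0 < q) (hq1 : q < 1) (K : ℕ)
    (hρ : 32 * q ^ ((K + 4) / 2) < 1) (θ : ℝ) :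
    (∑ k ∈ Finset.range (K + 1), q ^ (k * (k + 3) / 2) * ((2 * (k : ℝ) + 3) / 3) *
          (((k : ℝ) + 1) * ((k : ℝ) + 2) / 2) -
        (32 * q ^ ((K + 4) / 2)) ^ (K + 1) / (1 - 32 * q ^ ((K + 4) / 2))) *
      Real.exp (-θ ^ 2 / (4 * (-(Real.log q) / 2))) ≤
      zonal (-(Real.log q) / 2) (Real.cos θ) := by
  have hτ := neg_log_div_two_pos hq0 hq1
  have h := abs_le.1 (abs_zonal_one_sub_partialSum_le_geometric hq0 hq1 K hρ)
  refine le_trans (mul_le_mul_of_nonneg_right ?_ (Real.exp_pos _).le)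
    (zonal_one_mul_exp_neg_le_zonal_cos hτ θ)
  linarith [h.1]

/-! ### Usage (how a certificate cell evaluates these bounds with `norm_num`) -/

/-- `zonal ((log 4)/2) 1 ≥ 1.326` from four rational terms (`q = 1/4`, `K = 4`, `ρ = 1/8`).
[folklore] -/
example : (1326 / 1000 : ℝ) ≤ zonal (-(Real.log (1 / 4)) / 2) 1 := by
  have h := partialSum_sub_geometric_le_zonal (q := 1 / 4) (by norm_num) (by norm_num) 4 (s := 1)
    (by norm_num) (by norm_num)
  simp only [Finset.sum_range_succ, Finset.sum_range_zero, gegen_one] at h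
  norm_num at h
  linarith

/-- The explicit Gegenbauer sums unfold by `simp` + `norm_num`: `C_2^{(3/2)}(s) = (15 s² - 3)/2`.
[folklore] -/
example (s : ℝ) : gegen 2 s = 15 / 2 * s ^ 2 - 3 / 2 := by
  simp only [gegen, Finset.sum_range_succ, Finset.sum_range_zero, Finset.prod_range_succ,
    Finset.prod_range_zero, Nat.factorial]
  norm_num
  ring

end Literature.Geometry.Riemannian.SphericalZonalKernelSeries

end
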